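import Summits.BirchSwinnertonDyer.BirchSwinnertonDyer.Theorems.GenusKolyvaginAtTwoTorsionCellD0TripleTwistEightPrelims
import HarnessLib

/-!
# D0≤2, one genus step: `#Sel⁽²⁾(E₀^{(−p₀q₁q₂)}/ℚ) = 8` when `(q₁q₂/p₀) = +1` (parity-free)

Crux R″ `RankOneTwoTorsionResidualAtTwo` (stmt-27478), LINE 49 «full_vertex», stub D0≤2
`FullTorsionGenusSelmerLawUpToTwoAtTwo`, slice `#Q₀ = 2`, the rank-one genus twist `C₁ = E₀^{(−p₀M₀)}`, `M₀ = q₁q₂`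
(setting of `…D0TripleTwistBound`). When the two admissible primes have the same quadratic character mod `p`
(`w₁ = w₂`, i.e. `(q₁q₂/p) = +1`), the non-trivial `p`-unramified Selmer class predicted by the `ℤ/2`-elimination is
ALIGNED and is realised by an explicit class: `κ(T₃) + γ` with `γ = c(−p, −p)` (`w = 0`), `c(−pM, −p)` (`w = 1`,
`t = 0`) or `c(−p, −pM)` (`w = 1`, `t = 1`), whose local conditions are checked place by place (squares at `S`;
`≡ κ(T₃)` at `p` by (R2); `≡ 0 / κ(T₂) / κ(T₁)` at `qᵢ`; units at good primes; `≡ κ(T₂)` at `∞`). Hence `#N_p = 2` and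
**`#Sel⁽²⁾(E^{(−pq₁q₂)}/ℚ) = 8`** (`natCard_selmerGroup_twist_triple_eq_eight_of_qrBit_eq`). The complementary case
`(q₁q₂/p) = −1` is the `2`-parity case (LEAD memo `D0le2_memo.md` §2(b)) and is not treated here.

Everything is proved; no LINE 49 statement is restated; BSD is not advanced by this file alone.

## References

* [SilvermanAEC2009] J. H. Silverman, *The Arithmetic of Elliptic Curves*, 2nd ed., GTM 106, Prop. X.1.4, X.4.9.
* [Kramer1981] K. Kramer, *Arithmetic of elliptic curves upon quadratic extension*, Trans. AMS 264 (1981), Thm. 1.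
-/

noncomputable section

open scoped Classical

namespace Summit.BirchSwinnertonDyer.BirchSwinnertonDyer.Theorems.GenusKolyvaginAtTwo.TorsionCellD0

open WeierstrassCurve WeierstrassCurve.Affine WeierstrassCurve.Affine.Point
open Literature.NumberTheory.GaloisRepresentations Literature.NumberTheory.EllipticCurves Field
open Literature.NumberTheory.EllipticCurves.TwoDescentLocal
open Literature.NumberTheory.EllipticCurves.KramerTwoDescent
open IsDedekindDomain NumberField Rat.HeightOneSpectrum


/-! ## The explicit aligned class and the count `= 8` -/

section Eight

variable (E : WeierstrassCurve ℚ) [E.IsElliptic] {e₁ e₂ e₃ : ℚ}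
variable (S : Finset ℕ) {p q₁ q₂ : ℕ} [hp : Fact p.Prime] [hq₁ : Fact q₁.Prime] [hq₂ : Fact q₂.Prime]

/-- A bit of `ℤ/2` is `0` or `1`. [folklore] -/
private theorem zmod2_cases' (x : ZMod 2) : x = 0 ∨ x = 1 := by revert x; decide

/-- **`#Sel⁽²⁾(E₀^{(−p₀q₁q₂)}/ℚ) = 8` when `(q₁q₂/p₀) = +1`** (setting of the module docstring; `hw : qr_p(q₁) = qr_p(q₂)`;
`hr₁, hr₂`: the positive `S`-units `e₃ − e₁`, `e₃ − e₂` are residues at `p`, cf. `qrBit_sub_roots_eq_zero_of_intCast`).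
The class `κ(T₃) + c(−pX, −pY)`, `(X, Y) = (1,1), (q₁q₂, 1), (1, q₁q₂)` according to `(w, t)`, is a non-zero
`p`-unramified Selmer class, so `#N_p = 2`. [cite: SilvermanAEC2009, Prop. X.1.4, Thm. X.4.2, Prop. X.4.9]
[cite: Kramer1981, Thm. 1] -/
theorem natCard_selmerGroup_twist_triple_eq_eight_of_qrBit_eq (h : E.toAffine.SplitTwoTorsion e₁ e₂ e₃)
    (hS : ∀ q ∈ S, q.Prime) (h2S : 2 ∈ S) (h12 : e₁ < e₂) (h23 : e₂ < e₃)
    (hgood : ∀ ℓ : ℕ, (hℓ : ℓ.Prime) → ℓ ∉ S → haveI : Fact ℓ.Prime := ⟨hℓ⟩;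
      padicValRat ℓ (e₁ - e₂) = 0 ∧ padicValRat ℓ (e₁ - e₃) = 0 ∧ padicValRat ℓ (e₂ - e₃) = 0)
    (hN : ∀ ℓ : ℕ, ℓ.Prime → ℓ ∉ S → ¬ ℓ ∣ E.conductorNorm ℤ)
    (hrank : E.mordellWeilRank = 0) (hsha : ∀ x ∈ E.sha, (2 : ℕ) • x = 0 → x = 0)
    (hpS : p ∉ S) (hq₁S : q₁ ∉ S) (hq₂S : q₂ ∉ S) (hpq₁ : p ≠ q₁) (hpq₂ : p ≠ q₂) (hne : q₁ ≠ q₂)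
    (hp8 : p % 8 = 7) (hq₁4 : q₁ % 4 = 3) (hq₂4 : q₂ % 4 = 3) (hM8 : ((q₁ : ℤ) * q₂) % 8 = 1)
    (hsplitp : ∀ ℓ ∈ S, (hℓ : ℓ.Prime) → ℓ ≠ 2 → haveI : Fact ℓ.Prime := ⟨hℓ⟩; legendreSym ℓ (-(p : ℤ)) = 1)
    (hsplitM : ∀ ℓ ∈ S, (hℓ : ℓ.Prime) → ℓ ≠ 2 → haveI : Fact ℓ.Prime := ⟨hℓ⟩; legendreSym ℓ ((q₁ : ℤ) * q₂) = 1)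
    (hδ₁₁ : qrBit q₁ ((e₁ - e₂) * (e₁ - e₃)) = 1) (hδ₂₁ : qrBit q₁ ((e₂ - e₁) * (e₂ - e₃)) = 1)
    (hδ₁₂ : qrBit q₂ ((e₁ - e₂) * (e₁ - e₃)) = 1) (hδ₂₂ : qrBit q₂ ((e₂ - e₁) * (e₂ - e₃)) = 1)
    (ht : qrBit q₂ (e₂ - e₁) = qrBit q₁ (e₂ - e₁)) (hr₁ : qrBit p (e₃ - e₁) = 0) (hr₂ : qrBit p (e₃ - e₂) = 0)
    (hw : qrBit p (q₁ : ℚ) = qrBit p (q₂ : ℚ))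
    {d : ℚ} (hd : d = -(p : ℚ) * ((q₁ : ℚ) * q₂)) [(E.quadraticTwist d).IsElliptic] :
    Nat.card (selmerGroup (E.quadraticTwist d) 2) = 8 := by
  have h48 := natCard_selmerGroup_twist_triple_eq_four_or_eight E S h hS h2S h12 h23 hgood hN hrank hsha hpS hq₁S hq₂S hpq₁
    hpq₂ hne hp8 hq₁4 hq₂4 hM8 hsplitp hsplitM hδ₁₁ hδ₂₁ hδ₁₂ hδ₂₂ ht hd
  have hvd : padicValRat p d = 1 := by rw [hd]; exact padicValRat_negTriple_p hpq₁ hpq₂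
  have h4N := natCard_selmerGroup_quadraticTwist_eq_four_mul E h (q := p) hvd (hgood p hp.out hpS)
  subst hd
  have h' := h.quadraticTwist (-(p : ℚ) * ((q₁ : ℚ) * q₂))
  -- numerics
  have hp2 : p ≠ 2 := by rintro rfl; norm_num at hp8
  have hp4 : p % 4 = 3 := by omega
  have hq₁2 : q₁ ≠ 2 := by rintro rfl; norm_num at hq₁4
  have hq₂2 : q₂ ≠ 2 := by rintro rfl; norm_num at hq₂4
  have hp0 : (p : ℚ) ≠ 0 := by exact_mod_cast hp.out.ne_zero
  have hq₁0 : (q₁ : ℚ) ≠ 0 := by exact_mod_cast hq₁.out.ne_zero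
  have hq₂0 : (q₂ : ℚ) ≠ 0 := by exact_mod_cast hq₂.out.ne_zero
  have hM0 : (q₁ : ℚ) * q₂ ≠ 0 := mul_ne_zero hq₁0 hq₂0
  have hMpos : (0 : ℚ) < (q₁ : ℚ) * q₂ := by positivity
  have hd0 : -(p : ℚ) * ((q₁ : ℚ) * q₂) ≠ 0 := mul_ne_zero (neg_ne_zero.mpr hp0) hM0
  have hdneg : -(p : ℚ) * ((q₁ : ℚ) * q₂) < 0 := by
    have : (0 : ℚ) < p := by exact_mod_cast hp.out.pos
    nlinarith
  have he21 : (0 : ℚ) < e₂ - e₁ := by linarith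
  have he31 : (0 : ℚ) < e₃ - e₁ := by linarith
  have he32 : (0 : ℚ) < e₃ - e₂ := by linarith
  obtain ⟨g12p, g13p, g23p⟩ := hgood p hp.out hpS
  obtain ⟨g12₁, g13₁, g23₁⟩ := hgood q₁ hq₁.out hq₁S
  obtain ⟨g12₂, g13₂, g23₂⟩ := hgood q₂ hq₂.out hq₂S
  -- symbols
  have hm1p := qrBit_neg_one_eq_one (p := p) hp8
  have hm1₁ := qrBit_neg_one_eq_one_of_emod_four hq₁4
  have hm1₂ := qrBit_neg_one_eq_one_of_emod_four hq₂4
  have hwM : qrBit p ((q₁ : ℚ) * q₂) = 0 := by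
    rw [qrBit_mul p hq₁0 hq₂0, hw]; generalize qrBit p (q₂ : ℚ) = x; revert x; decide
  have hnegp₁ : qrBit q₁ (-(p : ℚ)) = qrBit p (q₁ : ℚ) := by
    rw [show (-(p : ℚ)) = (-1) * p by ring, qrBit_mul q₁ (by norm_num) hp0, hm1₁, qrBit_swap_eq_add_one hp4 hq₁4 hpq₁]
    generalize qrBit p (q₁ : ℚ) = x; revert x; decide
  have hnegp₂ : qrBit q₂ (-(p : ℚ)) = qrBit p (q₁ : ℚ) := by
    rw [show (-(p : ℚ)) = (-1) * p by ring, qrBit_mul q₂ (by norm_num) hp0, hm1₂, qrBit_swap_eq_add_one hp4 hq₂4 hpq₂, ← hw]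
    generalize qrBit p (q₁ : ℚ) = x; revert x; decide
  have ht₁' : qrBit q₁ (e₁ - e₂) = qrBit q₁ (e₂ - e₁) + 1 := by
    rw [show e₁ - e₂ = (-1) * (e₂ - e₁) by ring, qrBit_mul q₁ (by norm_num) he21.ne', hm1₁, add_comm]
  have ht₂' : qrBit q₂ (e₁ - e₂) = qrBit q₁ (e₂ - e₁) + 1 := by
    rw [show e₁ - e₂ = (-1) * (e₂ - e₁) by ring, qrBit_mul q₂ (by norm_num) he21.ne', hm1₂, ht, add_comm]
  -- the square parts `X`, `Y`
  set w := qrBit p (q₁ : ℚ) with hwdef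
  set t := qrBit q₁ (e₂ - e₁) with htdef
  set X : ℚ := if w = 1 ∧ t = 0 then (q₁ : ℚ) * q₂ else 1 with hX
  set Y : ℚ := if w = 1 ∧ t = 1 then (q₁ : ℚ) * q₂ else 1 with hY
  have hX0 : X ≠ 0 := by rw [hX]; split_ifs; exact hM0; exact one_ne_zero
  have hY0 : Y ≠ 0 := by rw [hY]; split_ifs; exact hM0; exact one_ne_zero
  have hXpos : 0 < X := by rw [hX]; split_ifs; exact hMpos; exact one_pos
  have hYpos : 0 < Y := by rw [hY]; split_ifs; exact hMpos; exact one_pos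
  have hγa0 : -(p : ℚ) * X ≠ 0 := mul_ne_zero (neg_ne_zero.mpr hp0) hX0
  have hγb0 : -(p : ℚ) * Y ≠ 0 := mul_ne_zero (neg_ne_zero.mpr hp0) hY0
  have hγaneg : -(p : ℚ) * X < 0 := by
    have : (0 : ℚ) < p := by exact_mod_cast hp.out.pos
    nlinarith
  have hγbneg : -(p : ℚ) * Y < 0 := by
    have : (0 : ℚ) < p := by exact_mod_cast hp.out.pos
    nlinarith

  -- the twisted roots `fᵢ = d eᵢ`: `f₁ > f₂ > f₃`
  have hf21 : (-(p : ℚ) * ((q₁ : ℚ) * q₂)) * e₂ < (-(p : ℚ) * ((q₁ : ℚ) * q₂)) * e₁ := mul_lt_mul_of_neg_left h12 hdneg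
  have hf32 : (-(p : ℚ) * ((q₁ : ℚ) * q₂)) * e₃ < (-(p : ℚ) * ((q₁ : ℚ) * q₂)) * e₂ := mul_lt_mul_of_neg_left h23 hdneg
  have hf31ne : (-(p : ℚ) * ((q₁ : ℚ) * q₂)) * e₃ - (-(p : ℚ) * ((q₁ : ℚ) * q₂)) * e₁ ≠ 0 := by linarith
  have hf32ne : (-(p : ℚ) * ((q₁ : ℚ) * q₂)) * e₃ - (-(p : ℚ) * ((q₁ : ℚ) * q₂)) * e₂ ≠ 0 := by linarith
  -- valuations / residues of the pieces at `p`, `q₁`, `q₂`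
  have hvX : ∀ {ℓ : ℕ} [Fact ℓ.Prime], ℓ ≠ q₁ → ℓ ≠ q₂ → padicValRat ℓ X = 0 := by
    intro ℓ _ h₁ h₂; rw [hX]; split_ifs; exact padicValRat_mul_primes_eq_zero h₁ h₂; exact padicValRat.one
  have hvY : ∀ {ℓ : ℕ} [Fact ℓ.Prime], ℓ ≠ q₁ → ℓ ≠ q₂ → padicValRat ℓ Y = 0 := by
    intro ℓ _ h₁ h₂; rw [hY]; split_ifs; exact padicValRat_mul_primes_eq_zero h₁ h₂; exact padicValRat.one
  have hqX : qrBit p X = 0 := by rw [hX]; split_ifs; exact hwM; rw [show (1 : ℚ) = 1 * 1 by norm_num, qrBit_mul_self]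
  have hqY : qrBit p Y = 0 := by rw [hY]; split_ifs; exact hwM; rw [show (1 : ℚ) = 1 * 1 by norm_num, qrBit_mul_self]
  have hvp_p : ∀ {ℓ : ℕ} [Fact ℓ.Prime], ℓ ≠ p → padicValRat ℓ (-(p : ℚ)) = 0 := by
    intro ℓ _ hℓp
    rw [padicValRat.neg, show (p : ℚ) = ((p : ℕ) : ℚ) from rfl, padicValRat.of_nat]
    exact_mod_cast padicValNat_primes hℓp
  -- at a twisting prime `q ∈ {q₁, q₂}`: `γ ≡ 0`, `κ(T₂)` or `κ(T₁)` according to `(w, t)`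
  have hq_place : ∀ {q : ℕ} [Fact q.Prime], q ≠ 2 → q ≠ p →
      qrBit q (-(p : ℚ)) = w → qrBit q (e₂ - e₁) = t → qrBit q (e₁ - e₂) = t + 1 →
      qrBit q ((e₁ - e₂) * (e₁ - e₃)) = 1 → qrBit q ((e₂ - e₁) * (e₂ - e₃)) = 1 →
      padicValRat q (e₁ - e₂) = 0 → padicValRat q (e₁ - e₃) = 0 → padicValRat q (e₂ - e₃) = 0 →
      ∀ v : HeightOneSpectrum (𝓞 ℚ), (primesEquiv v : ℕ) = q →
      (E.quadraticTwist (-(p : ℚ) * ((q₁ : ℚ) * q₂))).twoDescentClass h' (Units.mk0 _ hγa0) (Units.mk0 _ hγb0) ∈ selmerLocalKer (E.quadraticTwist (-(p : ℚ) * ((q₁ : ℚ) * q₂))) (v.adicCompletion ℚ) 2 := by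
    intro q _ hq2 hqp hqnegp hqt hqt' hqδ₁ hqδ₂ v12 v13 v23 v hv
    have v21 : padicValRat q (e₂ - e₁) = 0 := by rw [← neg_sub, padicValRat.neg, v12]
    have hvnegp : padicValRat q (-(p : ℚ)) = 0 := hvp_p hqp
    have he12ne : e₁ - e₂ ≠ 0 := by linarith
    have he13ne : e₁ - e₃ ≠ 0 := by linarith
    have he23ne : e₂ - e₃ ≠ 0 := by linarith
    rcases zmod2_cases' w with hw0 | hw1
    · -- `w = 0`: `γ = c(−p, −p)`, both components squares at `q`
      have hX1 : X = 1 := by rw [hX, if_neg]; rintro ⟨h1, -⟩; rw [hw0] at h1; exact zero_ne_one h1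
      have hY1 : Y = 1 := by rw [hY, if_neg]; rintro ⟨h1, -⟩; rw [hw0] at h1; exact zero_ne_one h1
      have hsq : IsSquare (algebraMap ℚ (v.adicCompletion ℚ) ((1 : ℚ) ^ 2 * (-(p : ℚ)))) :=
        isSquare_adicCompletion_sq_mul_of_bits v hv hq2 one_ne_zero (neg_ne_zero.mpr hp0) hvnegp (by rw [hqnegp, hw0])
      rw [one_pow, one_mul] at hsq
      exact twoDescentClass_mem_selmerLocalKer_of_isSquare (E.quadraticTwist (-(p : ℚ) * ((q₁ : ℚ) * q₂))) h' _
        (charZero_of_injective_algebraMap (algebraMap ℚ _).injective) (Units.mk0 _ hγa0) (Units.mk0 _ hγb0)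
        (by rw [Units.val_mk0, hX1, mul_one]; exact hsq) (by rw [Units.val_mk0, hY1, mul_one]; exact hsq)
    · rcases zmod2_cases' t with ht0 | ht1
      · -- `w = 1`, `t = 0`: `γ = c(−pM, −p) ≡ κ(T₂)`
        have hXM : X = (q₁ : ℚ) * q₂ := by rw [hX, if_pos ⟨hw1, ht0⟩]
        have hY1 : Y = 1 := by rw [hY, if_neg]; rintro ⟨-, h1⟩; rw [ht0] at h1; exact zero_ne_one h1
        refine twoDescentClass_mem_selmerLocalKer_of_isSquare_T₂ (E.quadraticTwist (-(p : ℚ) * ((q₁ : ℚ) * q₂))) h' _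
          (charZero_of_injective_algebraMap (algebraMap ℚ _).injective) (Units.mk0 _ hγa0) (Units.mk0 _ hγb0) ?_ ?_
        · rw [Units.val_mk0, hXM, show -(p : ℚ) * ((q₁ : ℚ) * q₂) * ((-(p : ℚ) * ((q₁ : ℚ) * q₂)) * e₂ - (-(p : ℚ) * ((q₁ : ℚ) * q₂)) * e₁) =
            ((p : ℚ) * ((q₁ : ℚ) * q₂)) ^ 2 * (e₂ - e₁) by ring]
          exact isSquare_adicCompletion_sq_mul_of_bits v hv hq2 (mul_ne_zero hp0 hM0) he21.ne' v21 (by rw [hqt, ht0])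
        · rw [Units.val_mk0, hY1, mul_one, show -(p : ℚ) * (((-(p : ℚ) * ((q₁ : ℚ) * q₂)) * e₂ - (-(p : ℚ) * ((q₁ : ℚ) * q₂)) * e₁) * ((-(p : ℚ) * ((q₁ : ℚ) * q₂)) * e₂ - (-(p : ℚ) * ((q₁ : ℚ) * q₂)) * e₃)) =
            (-(p : ℚ) * ((q₁ : ℚ) * q₂)) ^ 2 * (-(p : ℚ) * ((e₂ - e₁) * (e₂ - e₃))) by ring]
          refine isSquare_adicCompletion_sq_mul_of_bits v hv hq2 hd0 (mul_ne_zero (neg_ne_zero.mpr hp0) (mul_ne_zero he21.ne' he23ne)) ?_ ?_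
          · rw [padicValRat.mul (neg_ne_zero.mpr hp0) (mul_ne_zero he21.ne' he23ne), hvnegp, padicValRat.mul he21.ne' he23ne,
              v21, v23]; rfl
          · rw [qrBit_mul q (neg_ne_zero.mpr hp0) (mul_ne_zero he21.ne' he23ne), hqnegp, hqδ₂, hw1]; decide
      · -- `w = 1`, `t = 1`: `γ = c(−p, −pM) ≡ κ(T₁)`
        have hX1 : X = 1 := by rw [hX, if_neg]; rintro ⟨-, h1⟩; rw [ht1] at h1; exact one_ne_zero h1
        have hYM : Y = (q₁ : ℚ) * q₂ := by rw [hY, if_pos ⟨hw1, ht1⟩]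
        refine twoDescentClass_mem_selmerLocalKer_of_isSquare_T₁ (E.quadraticTwist (-(p : ℚ) * ((q₁ : ℚ) * q₂))) h' _
          (charZero_of_injective_algebraMap (algebraMap ℚ _).injective) (Units.mk0 _ hγa0) (Units.mk0 _ hγb0) ?_ ?_
        · rw [Units.val_mk0, hX1, mul_one, show -(p : ℚ) * (((-(p : ℚ) * ((q₁ : ℚ) * q₂)) * e₁ - (-(p : ℚ) * ((q₁ : ℚ) * q₂)) * e₂) * ((-(p : ℚ) * ((q₁ : ℚ) * q₂)) * e₁ - (-(p : ℚ) * ((q₁ : ℚ) * q₂)) * e₃)) =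
            (-(p : ℚ) * ((q₁ : ℚ) * q₂)) ^ 2 * (-(p : ℚ) * ((e₁ - e₂) * (e₁ - e₃))) by ring]
          refine isSquare_adicCompletion_sq_mul_of_bits v hv hq2 hd0 (mul_ne_zero (neg_ne_zero.mpr hp0) (mul_ne_zero he12ne he13ne)) ?_ ?_
          · rw [padicValRat.mul (neg_ne_zero.mpr hp0) (mul_ne_zero he12ne he13ne), hvnegp, padicValRat.mul he12ne he13ne,
              v12, v13]; rfl
          · rw [qrBit_mul q (neg_ne_zero.mpr hp0) (mul_ne_zero he12ne he13ne), hqnegp, hqδ₁, hw1]; decide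
        · rw [Units.val_mk0, hYM, show -(p : ℚ) * ((q₁ : ℚ) * q₂) * ((-(p : ℚ) * ((q₁ : ℚ) * q₂)) * e₁ - (-(p : ℚ) * ((q₁ : ℚ) * q₂)) * e₂) =
            ((p : ℚ) * ((q₁ : ℚ) * q₂)) ^ 2 * (e₁ - e₂) by ring]
          exact isSquare_adicCompletion_sq_mul_of_bits v hv hq2 (mul_ne_zero hp0 hM0) he12ne v12 (by rw [hqt', ht1]; decide)
  -- the class `γ = c(−pX, −pY)` is Selmer
  have hγS : (E.quadraticTwist (-(p : ℚ) * ((q₁ : ℚ) * q₂))).twoDescentClass h' (Units.mk0 _ hγa0) (Units.mk0 _ hγb0) ∈ selmerGroup (E.quadraticTwist (-(p : ℚ) * ((q₁ : ℚ) * q₂))) 2 := by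
    rw [mem_selmerGroup_iff]
    refine ⟨fun v => ?_, fun w' => ?_⟩
    · by_cases hvS : (primesEquiv v : ℕ) ∈ S
      · -- places of `S`: both components are squares
        have hsqp : IsSquare (algebraMap ℚ (v.adicCompletion ℚ) (-(p : ℚ))) := by
          by_cases hv2 : (primesEquiv v : ℕ) = 2
          · exact isSquare_neg_prime_adicCompletion_two (p := p) hp8 v hv2
          · haveI : Fact (primesEquiv v : ℕ).Prime := ⟨(primesEquiv v).2⟩
            exact isSquare_neg_prime_adicCompletion_odd (p := p) v rfl hv2 (fun h => hpS (h ▸ hvS))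
              (hsplitp _ hvS (primesEquiv v).2 hv2)
        have hsqM : IsSquare (algebraMap ℚ (v.adicCompletion ℚ) ((q₁ : ℚ) * q₂)) := by
          by_cases hv2 : (primesEquiv v : ℕ) = 2
          · exact isSquare_mul_adicCompletion_two (q₁ := q₁) (q₂ := q₂) hq₁4 hq₂4 hM8 v hv2
          · haveI : Fact (primesEquiv v : ℕ).Prime := ⟨(primesEquiv v).2⟩
            exact isSquare_mul_adicCompletion_of_legendreSym (q₁ := q₁) (q₂ := q₂) v rfl hv2
              (fun h => hq₁S (h ▸ hvS)) (fun h => hq₂S (h ▸ hvS)) (hsplitM _ hvS (primesEquiv v).2 hv2)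
        have h1 : IsSquare (algebraMap ℚ (v.adicCompletion ℚ) (1 : ℚ)) := ⟨1, by rw [map_one, mul_one]⟩
        have hsqX : IsSquare (algebraMap ℚ (v.adicCompletion ℚ) X) := by rw [hX]; split_ifs; exact hsqM; exact h1
        have hsqY : IsSquare (algebraMap ℚ (v.adicCompletion ℚ) Y) := by rw [hY]; split_ifs; exact hsqM; exact h1
        exact twoDescentClass_mem_selmerLocalKer_of_isSquare (E.quadraticTwist (-(p : ℚ) * ((q₁ : ℚ) * q₂))) h' _
          (charZero_of_injective_algebraMap (algebraMap ℚ _).injective) (Units.mk0 _ hγa0) (Units.mk0 _ hγb0)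
          (by rw [Units.val_mk0, map_mul]; exact hsqp.mul hsqX) (by rw [Units.val_mk0, map_mul]; exact hsqp.mul hsqY)
      · by_cases hvp : (primesEquiv v : ℕ) = p
        · -- at `p`: `γ ≡ κ(T₃)` (by (R2) and `w₁ = w₂`)
          refine twoDescentClass_mem_selmerLocalKer_of_isSquare_T₃ (E.quadraticTwist (-(p : ℚ) * ((q₁ : ℚ) * q₂))) h' _
            (charZero_of_injective_algebraMap (algebraMap ℚ _).injective) (Units.mk0 _ hγa0) (Units.mk0 _ hγb0) ?_ ?_
          · rw [Units.val_mk0, show -(p : ℚ) * X * ((-(p : ℚ) * ((q₁ : ℚ) * q₂)) * e₃ - (-(p : ℚ) * ((q₁ : ℚ) * q₂)) * e₁) = (p : ℚ) ^ 2 * (X * ((q₁ : ℚ) * q₂) * (e₃ - e₁)) by ring]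
            refine isSquare_adicCompletion_sq_mul_of_bits v hvp hp2 hp0 (mul_ne_zero (mul_ne_zero hX0 hM0) he31.ne') ?_ ?_
            · rw [padicValRat.mul (mul_ne_zero hX0 hM0) he31.ne', padicValRat.mul hX0 hM0, hvX hpq₁ hpq₂,
                padicValRat_mul_primes_eq_zero hpq₁ hpq₂, ← neg_sub, padicValRat.neg, g13p]; rfl
            · rw [qrBit_mul p (mul_ne_zero hX0 hM0) he31.ne', qrBit_mul p hX0 hM0, hqX, hwM, hr₁]; decide
          · rw [Units.val_mk0, show -(p : ℚ) * Y * ((-(p : ℚ) * ((q₁ : ℚ) * q₂)) * e₃ - (-(p : ℚ) * ((q₁ : ℚ) * q₂)) * e₂) = (p : ℚ) ^ 2 * (Y * ((q₁ : ℚ) * q₂) * (e₃ - e₂)) by ring]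
            refine isSquare_adicCompletion_sq_mul_of_bits v hvp hp2 hp0 (mul_ne_zero (mul_ne_zero hY0 hM0) he32.ne') ?_ ?_
            · rw [padicValRat.mul (mul_ne_zero hY0 hM0) he32.ne', padicValRat.mul hY0 hM0, hvY hpq₁ hpq₂,
                padicValRat_mul_primes_eq_zero hpq₁ hpq₂, ← neg_sub, padicValRat.neg, g23p]; rfl
            · rw [qrBit_mul p (mul_ne_zero hY0 hM0) he32.ne', qrBit_mul p hY0 hM0, hqY, hwM, hr₂]; decide
        · by_cases hv₁ : (primesEquiv v : ℕ) = q₁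
          · exact hq_place hq₁2 (Ne.symm hpq₁) hnegp₁ rfl ht₁' hδ₁₁ hδ₂₁ g12₁ g13₁ g23₁ v hv₁
          · by_cases hv₂ : (primesEquiv v : ℕ) = q₂
            · exact hq_place hq₂2 (Ne.symm hpq₂) hnegp₂ ht ht₂' hδ₁₂ hδ₂₂ g12₂ g13₂ g23₂ v hv₂
            · -- a good prime of the twist: unit integer components
              have hℓ := (primesEquiv v).2
              haveI : Fact (primesEquiv v : ℕ).Prime := ⟨hℓ⟩
              have hℓ2 : (primesEquiv v : ℕ) ≠ 2 := fun h2 => hvS (h2 ▸ h2S)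
              have hgoodv : (E.quadraticTwist (-(p : ℚ) * ((q₁ : ℚ) * q₂))).HasGoodReductionAt v := by
                by_contra hbad
                have hdvd := ((E.quadraticTwist (-(p : ℚ) * ((q₁ : ℚ) * q₂))).dvd_conductorNorm_iff v).mpr hbad
                have hdZ0 : (-(p : ℤ) * (q₁ * q₂) : ℤ) ≠ 0 := by
                  have : (((-(p : ℤ) * (q₁ * q₂) : ℤ)) : ℚ) = (-(p : ℚ) * ((q₁ : ℚ) * q₂)) := by push_cast; ring
                  intro h0; rw [h0, Int.cast_zero] at this; exact hd0 this.symm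
                have hndvd : ¬ ((primesEquiv v : ℕ) : ℤ) ∣ (-(p : ℤ) * (q₁ * q₂)) := by
                  rw [neg_mul, dvd_neg]
                  intro hd'
                  have hpr : Prime ((primesEquiv v : ℕ) : ℤ) := Nat.prime_iff_prime_int.mp hℓ
                  rcases hpr.dvd_or_dvd hd' with h1 | h1
                  · exact hvp ((Nat.prime_dvd_prime_iff_eq hℓ hp.out).mp (Int.natCast_dvd_natCast.mp h1))
                  · rcases hpr.dvd_or_dvd h1 with h2 | h2
                    · exact hv₁ ((Nat.prime_dvd_prime_iff_eq hℓ hq₁.out).mp (Int.natCast_dvd_natCast.mp h2))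
                    · exact hv₂ ((Nat.prime_dvd_prime_iff_eq hℓ hq₂.out).mp (Int.natCast_dvd_natCast.mp h2))
                have hnot := not_dvd_conductorNorm_quadraticTwist_of_not_dvd E hℓ hℓ2 (hN _ hℓ hvS) hdZ0 hndvd
                rw [show (((-(p : ℤ) * (q₁ * q₂) : ℤ)) : ℚ) = (-(p : ℚ) * ((q₁ : ℚ) * q₂)) by push_cast; ring] at hnot
                exact hnot hdvd
              obtain ⟨ma, hma⟩ : ∃ m : ℤ, (m : ℚ) = -(p : ℚ) * X :=
                ⟨if w = 1 ∧ t = 0 then -(p : ℤ) * (q₁ * q₂) else -(p : ℤ), by rw [hX]; split_ifs <;> push_cast <;> ring⟩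
              obtain ⟨mb, hmb⟩ : ∃ m : ℤ, (m : ℚ) = -(p : ℚ) * Y :=
                ⟨if w = 1 ∧ t = 1 then -(p : ℤ) * (q₁ * q₂) else -(p : ℤ), by rw [hY]; split_ifs <;> push_cast <;> ring⟩
              have hma0 : (ma : ℚ) ≠ 0 := by rw [hma]; exact hγa0
              have hmb0 : (mb : ℚ) ≠ 0 := by rw [hmb]; exact hγb0
              have hndvd_of : ∀ {m : ℤ}, (m : ℚ) ≠ 0 → padicValRat (primesEquiv v : ℕ) (m : ℚ) = 0 →
                  ¬ ((primesEquiv v : ℕ) : ℤ) ∣ m := by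
                intro m hm0 hv0 hdm
                rw [padicValRat.of_int] at hv0
                have h0 : padicValInt (primesEquiv v : ℕ) m = 0 := by exact_mod_cast hv0
                rcases padicValInt.eq_zero_iff.mp h0 with h1 | h1 | h1
                · exact hℓ.ne_one h1
                · exact hm0 (by rw [h1, Int.cast_zero])
                · exact h1 hdm
              refine (E.quadraticTwist (-(p : ℚ) * ((q₁ : ℚ) * q₂))).twoDescentClass_mem_selmerLocalKer_of_mk_eq_intCast h' v hℓ2 hgoodv _ _ ma mb hma0 hmb0 ?_ ?_
                (hndvd_of hma0 (by rw [hma, padicValRat.mul (neg_ne_zero.mpr hp0) hX0, hvp_p hvp, hvX hv₁ hv₂, add_zero]))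
                (hndvd_of hmb0 (by rw [hmb, padicValRat.mul (neg_ne_zero.mpr hp0) hY0, hvp_p hvp, hvY hv₁ hv₂, add_zero]))
              · congr 1; exact Units.ext (by rw [Units.val_mk0, Units.val_mk0, hma])
              · congr 1; exact Units.ext (by rw [Units.val_mk0, Units.val_mk0, hmb])
    · -- the real place: `γ ≡ κ(T₂)` (both components negative)
      refine twoDescentClass_mem_selmerLocalKer_of_isSquare_T₂ (E.quadraticTwist (-(p : ℚ) * ((q₁ : ℚ) * q₂))) h' _
        (charZero_of_injective_algebraMap (algebraMap ℚ _).injective) (Units.mk0 _ hγa0) (Units.mk0 _ hγb0) ?_ ?_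
      · rw [Units.val_mk0]
        exact isSquare_algebraMap_completion_of_pos w' (mul_pos_of_neg_of_neg hγaneg (by linarith))
      · rw [Units.val_mk0]
        refine isSquare_algebraMap_completion_of_pos w' (mul_pos_of_neg_of_neg hγbneg (mul_neg_of_neg_of_pos ?_ ?_))
        · linarith
        · linarith
  -- the class `c₀ = κ(T₃) + γ`: Selmer, `p`-unramified, non-zero
  have hκ₃S := twoDescentClass_mem_selmerGroup_T₃ (E.quadraticTwist (-(p : ℚ) * ((q₁ : ℚ) * q₂))) h' (Units.mk0 _ hf31ne) (Units.mk0 _ hf32ne) rfl rfl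
  have hc₀S := add_mem hκ₃S hγS
  have hc₀a := (E.quadraticTwist (-(p : ℚ) * ((q₁ : ℚ) * q₂))).kummerEquiv_twoTorsionCharH1_add h' (Units.mk0 _ hf31ne) (Units.mk0 _ hγa0)
    ((E.quadraticTwist (-(p : ℚ) * ((q₁ : ℚ) * q₂))).kummerEquiv_twoTorsionCharH1_twoDescentClass h' _ (Units.mk0 _ hf32ne))
    ((E.quadraticTwist (-(p : ℚ) * ((q₁ : ℚ) * q₂))).kummerEquiv_twoTorsionCharH1_twoDescentClass h' _ (Units.mk0 _ hγb0))
  have hc₀b := (E.quadraticTwist (-(p : ℚ) * ((q₁ : ℚ) * q₂))).kummerEquiv_twoTorsionCharH1_add h'.swap₁₂ (Units.mk0 _ hf32ne) (Units.mk0 _ hγb0)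
    ((E.quadraticTwist (-(p : ℚ) * ((q₁ : ℚ) * q₂))).kummerEquiv_twoTorsionCharH1_swap_twoDescentClass h' (Units.mk0 _ hf31ne) _)
    ((E.quadraticTwist (-(p : ℚ) * ((q₁ : ℚ) * q₂))).kummerEquiv_twoTorsionCharH1_swap_twoDescentClass h' (Units.mk0 _ hγa0) _)
  -- the components of `c₀` are `p² · (MX(e₃−e₁))`, `p² · (MY(e₃−e₂))`
  have hca : ((Units.mk0 _ hf31ne * Units.mk0 _ hγa0 : ℚˣ) : ℚ) = (p : ℚ) ^ 2 * (((q₁ : ℚ) * q₂) * X * (e₃ - e₁)) := by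
    rw [Units.val_mul, Units.val_mk0, Units.val_mk0]; ring
  have hcb : ((Units.mk0 _ hf32ne * Units.mk0 _ hγb0 : ℚˣ) : ℚ) = (p : ℚ) ^ 2 * (((q₁ : ℚ) * q₂) * Y * (e₃ - e₂)) := by
    rw [Units.val_mul, Units.val_mk0, Units.val_mk0]; ring
  have hua0 : ((q₁ : ℚ) * q₂) * X * (e₃ - e₁) ≠ 0 := mul_ne_zero (mul_ne_zero hM0 hX0) he31.ne'
  have hub0 : ((q₁ : ℚ) * q₂) * Y * (e₃ - e₂) ≠ 0 := mul_ne_zero (mul_ne_zero hM0 hY0) he32.ne'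
  have hvM_p : padicValRat p ((q₁ : ℚ) * q₂) = 0 := padicValRat_mul_primes_eq_zero hpq₁ hpq₂
  have hpa : parityBit p ((Units.mk0 _ hf31ne * Units.mk0 _ hγa0 : ℚˣ) : ℚ) = 0 := by
    rw [hca]
    refine parityBit_sq_mul hp0 hua0 ?_
    rw [padicValRat.mul (mul_ne_zero hM0 hX0) he31.ne', padicValRat.mul hM0 hX0, hvM_p, hvX hpq₁ hpq₂, ← neg_sub,
      padicValRat.neg, g13p]; rfl
  have hpb : parityBit p ((Units.mk0 _ hf32ne * Units.mk0 _ hγb0 : ℚˣ) : ℚ) = 0 := by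
    rw [hcb]
    refine parityBit_sq_mul hp0 hub0 ?_
    rw [padicValRat.mul (mul_ne_zero hM0 hY0) he32.ne', padicValRat.mul hM0 hY0, hvM_p, hvY hpq₁ hpq₂, ← neg_sub,
      padicValRat.neg, g23p]; rfl
  -- `c₀ ≠ 0`: one of its `q₁`-parities is odd (`X = M` and `Y = M` exclude each other)
  have hv₁M : padicValRat q₁ ((q₁ : ℚ) * q₂) = 1 := by
    rw [padicValRat.mul hq₁0 hq₂0, padicValRat.self hq₁.out.one_lt, show (q₂ : ℚ) = ((q₂ : ℕ) : ℚ) from rfl,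
      padicValRat.of_nat]
    have := padicValNat_primes (p := q₁) (q := q₂) hne
    rw [this]; rfl
  have hv₁p : padicValRat q₁ (p : ℚ) = 0 := by
    rw [show (p : ℚ) = ((p : ℕ) : ℚ) from rfl, padicValRat.of_nat]; exact_mod_cast padicValNat_primes (Ne.symm hpq₁)
  have hc₀ne : (E.quadraticTwist (-(p : ℚ) * ((q₁ : ℚ) * q₂))).twoDescentClass h' (Units.mk0 _ hf31ne) (Units.mk0 _ hf32ne) +
      (E.quadraticTwist (-(p : ℚ) * ((q₁ : ℚ) * q₂))).twoDescentClass h' (Units.mk0 _ hγa0) (Units.mk0 _ hγb0) ≠ 0 := by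
    intro h0
    have hpa₁ := (E.quadraticTwist (-(p : ℚ) * ((q₁ : ℚ) * q₂))).parityHom_kummerEquiv_eq_parityBit h' q₁ hc₀a
    have hpb₁ := (E.quadraticTwist (-(p : ℚ) * ((q₁ : ℚ) * q₂))).parityHom_kummerEquiv_eq_parityBit h'.swap₁₂ q₁ hc₀b
    rw [h0, _root_.map_zero, _root_.map_zero, _root_.map_zero] at hpa₁ hpb₁
    rw [hca, parityBit_mul (pow_ne_zero 2 hp0) hua0, parityBit_mul (mul_ne_zero hM0 hX0) he31.ne',
      parityBit_mul hM0 hX0] at hpa₁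
    rw [hcb, parityBit_mul (pow_ne_zero 2 hp0) hub0, parityBit_mul (mul_ne_zero hM0 hY0) he32.ne',
      parityBit_mul hM0 hY0] at hpb₁
    have hP2 : parityBit q₁ ((p : ℚ) ^ 2) = 0 := parityBit_eq_zero_iff.mpr ⟨padicValRat q₁ (p : ℚ), by
      rw [padicValRat.pow (p : ℚ)]; ring⟩
    have hPM : parityBit q₁ ((q₁ : ℚ) * q₂) = 1 := by rw [parityBit, hv₁M]; rfl
    have hP31 : parityBit q₁ (e₃ - e₁) = 0 := by rw [parityBit, ← neg_sub, padicValRat.neg, g13₁]; rfl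
    have hP32 : parityBit q₁ (e₃ - e₂) = 0 := by rw [parityBit, ← neg_sub, padicValRat.neg, g23₁]; rfl
    rw [hP2, hPM, hP31] at hpa₁
    rw [hP2, hPM, hP32] at hpb₁
    -- `parityBit q₁ X = 1` and `parityBit q₁ Y = 1` would need `t = 0` and `t = 1`
    have hPX : parityBit q₁ X = 1 := by revert hpa₁; generalize parityBit q₁ X = x; revert x; decide
    have hPY : parityBit q₁ Y = 1 := by revert hpb₁; generalize parityBit q₁ Y = y; revert y; decide
    have hXc : w = 1 ∧ t = 0 := by
      by_contra hc; rw [hX, if_neg hc, parityBit, padicValRat.one] at hPX; exact zero_ne_one hPX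
    have hYc : w = 1 ∧ t = 1 := by
      by_contra hc; rw [hY, if_neg hc, parityBit, padicValRat.one] at hPY; exact zero_ne_one hPY
    exact zero_ne_one (hXc.2.symm.trans hYc.2)
  -- count: `N_p ∋ 0, c₀`, so `#N_p ≠ 1`, so `#Sel⁽²⁾ ≠ 4`
  rcases h48 with h4 | h8
  · exfalso
    rw [h4N] at h4
    refine natCard_unramified_ne_one (E.quadraticTwist (-(p : ℚ) * ((q₁ : ℚ) * q₂))) (h.quadraticTwist (-(p : ℚ) * ((q₁ : ℚ) * q₂))) p hc₀S ?_ ?_ hc₀ne (by omega)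
    · rw [(E.quadraticTwist (-(p : ℚ) * ((q₁ : ℚ) * q₂))).parityHom_kummerEquiv_eq_parityBit h' p hc₀a]; exact hpa
    · rw [(E.quadraticTwist (-(p : ℚ) * ((q₁ : ℚ) * q₂))).parityHom_kummerEquiv_eq_parityBit h'.swap₁₂ p hc₀b]; exact hpb
  · exact h8

end Eight

end Summit.BirchSwinnertonDyer.BirchSwinnertonDyer.Theorems.GenusKolyvaginAtTwo.TorsionCellD0

end
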